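import Mathlib
import HarnessLib
import HarnessLib.Audit
import Summits.QuantumFields.Statement
import Summits.QuantumFields.QCD.Statement
import Literature.MathematicalPhysics.QuantumFieldTheory.OverlapQCDOS
import HarnessLib.Audit.Status.Attr

/-!
Route: OverlapPositivityTransfer

DORMANT since 2026-08-29T21:02:14Z (census g0: costume (trib-confirmed census-trib-costume-A 2026-08-29; 21-frontier 19:16:23Z (b)); reversible --off) — unstaffed, not closed; items shared with open routes are served there. `ledger route dormant <id> --off` reactivates.

# Route OverlapPositivityTransfer — N_f = 3 positivity is a choice of regularisation — massive QCD
in admissible-overlap lattice QCD, returned to Wilson by a lattice-level universality transfer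

X = OverlapQCD ∧ Transfer ("it suffices to show X"; realises idea card
overlap-positivity-universality, its U1 = Transfer, U2 ⊂ OverlapQCD, U3 = the support items).
OverlapQCD (the (O)-WORLD TWIN OF THE CONJUNCT): `QCDOf 2 ∧ QCDOf 3` with every Wilson lattice
functional replaced by the one of
ADMISSIBLE-OVERLAP lattice QCD — gauge weight `∏_p 1[t_p < 1/1800]·exp(−β t_p/(1−1800 t_p))`, `t_p =
Re tr(1−U_p)` (trace form of
Lüscher's admissibility `‖1−U_p‖ < 1/30`), and `N_f` flavours of MASSIVE NEUBERGER OVERLAP quarks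
`D_μ = (1+μ/2) + (1−μ/2)·Γ₅ sign(Γ₅D_W(U,−1,1))`
(`m₀ = 1`, `r = 1`, bare masses `μ_f(k) = m_crit(k) + a_k m_f/Z_m(k)` eventually in `(0,2)`),
Berezin-integrated exactly as in `qcdTorusExpect` /
`qcdLatticeSchwinger`: same `QCDRegularisation` data, same species and insertions, same `OSData`
target, same lattice-gap clause over ALL
`QCDLatticeObservable`s. In this world the `N_f = 3` unquenched gauge marginal is a PROBABILITY
measure (support items), chiral symmetry is
exact (no additive mass renormalisation, no Aoki phase, no exceptional configurations) and the
operator is uniformly exponentially local.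
THE CHIRAL CLAUSE (rev 3, statement re-type 2026-08-16: `QCDOf` conjoins `reg.IsChiralAtZero`, the
lattice gap closes as `m → 0⁺`) is
SUPPLIED where chiral symmetry is exact: the overlap body is taken at the CANONICAL chiral point
`m_crit ≡ 0` (no additive mass
renormalisation for Ginsparg–Wilson quarks, so `m → 0⁺` is `μ → 0⁺` and no offset can hide light
quarks) and carries the subsequence-stable
twin `reg.OverlapGapClosesAtZero` (the overlap gap bound fails EVENTUALLY in k at some positive
mass, for every rate) — proved by the new crux
OverlapGoldstone (Goldstone's alternative from the exact lattice Ward identity `μ·G_ab(p=0) =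
δ_ab⟨ψ̄(1−aD/2)ψ⟩/a⁴`) — and the transfer
carries gap CLOSURE, together with everything else, back to Wilson's `IsChiralAtZero`.
Transfer: `OverlapChiralQCDOf N_f` (N_f = 2, 3) `→ QCD` — a lattice-level universality theorem
returning to the statement's Wilson scheme.
The overlap body is split as OverlapLatticeGap (infrared at zero offset, rank 3),
OverlapContinuumLimit (ultraviolet/axioms, rank 4) and
OverlapGoldstone (gap closure at the chiral point, rank 5); Transfer is rank 2.
Vocabulary (rev 2, route-repair 2026-08-15; rev 3, 2026-08-16): every item is stated over the landed
Literature twins of the `QCDOS`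
functionals — `qcdOverlapDirac`, `overlapBoltzmann`, `overlapGaugeWeight`, `overlapTorusExpect`,
`QCDScheme.OverlapHasLatticeMassGap`,
`IsOverlapQCDAlong`, and (section ChiralPoint, rev 3) `QCDRegularisation.OverlapIsChiralAtZero` /
`OverlapGapClosesAtZero` /
`HasOverlapGapAtPositiveMass`, `OverlapChiralQCDOf` (twin of the RE-TYPED `QCDOf`),
`OverlapChiralGapPackage`
(Literature/MathematicalPhysics/QuantumFieldTheory/OverlapQCDOS.lean; the rev-2 `OverlapQCDOf` /
`OverlapGapPackage` are their forgetful images) —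
and Transfer is aimed at the Statement decl `QCD` itself (joint over N_f = 2, 3), so the route's
used-constants cone is Literature
vocabulary + the Statement (no direct `QCDOf`).
Lean: `(open Literature.MathematicalPhysics.QuantumFieldTheory in (∀ Nf : ℕ, Nf = 2 ∨ Nf = 3 →
OverlapChiralQCDOf Nf) ∧ ((∀ Nf : ℕ, Nf = 2 ∨ Nf = 3 → OverlapChiralQCDOf Nf) → QCD))`

## Assembly
Pure logic, machine-checked in the planner's Sketch.lean (`theorem assembly_holds`, rc 0): for N_f =
2 and N_f = 3, OverlapLatticeGap gives a
ZERO-OFFSET regularisation `reg` with the positive-mass gap package, OverlapGoldstone applied to the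
SAME `reg` gives `reg.OverlapGapClosesAtZero`,
together the chiral package `OverlapChiralGapPackage N_f`; OverlapContinuumLimit upgrades it to the
chiral overlap body `OverlapChiralQCDOf N_f`;
WilsonOverlapTransfer turns the pair of bodies into `QCD`
(`closes := fun hA hG hB hC => hC fun Nf h => hB Nf h ⟨reg, hMS, hG Nf h reg h0 hMS (fun m hm =>
(hbody m hm).1), hbody⟩` after
`obtain ⟨reg, h0, hMS, hbody⟩ := hA Nf h`).
The support items are not in the chain: they certify the selling point (positivity is a theorem in
the overlap world) and are the first
lemmas any prover of OverlapLatticeGap needs. Reflection positivity of T is deliberately left to the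
prover of OverlapContinuumLimit (continuum
or Wilson-side sourcing, see Not decomposed yet).

Rationale: WHY THIS LINE. Every fermionic pathology met inside Wilson's scheme at `N_f = 3` — the signed
determinant (Literature.Barriers.QuantumFields.WilsonDeterminantSign,
MohlerSchaefer2020), additive mass renormalisation and the Aoki structure (SharpeSingleton1998),
exceptional configurations — is absent BY THEOREM
for Ginsparg–Wilson quarks (GinspargWilson1982, Neuberger1998, Luscher1998): `γ₅`-hermiticity plus
the GW circle give `det(D_ov+μ) > 0` per
flavour and per mass splitting (support items GinspargWilsonPositivity /
OverlapDeterminantPositivity, provable now), and Lüscher's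
admissibility makes `D_ov` smooth and uniformly exponentially local (Luscher1999AbelianChiral,
HernandezJansenLuscher1999). So the infrared of
massive QCD is posed where probabilistic tools for POSITIVE Gibbs measures on `SU(3)^E` apply
(OverlapLatticeGap), and the price is paid
in the ultraviolet, where constructive QFT is strongest: a lattice-level universality theorem Wilson
⇐ overlap (WilsonOverlapTransfer),
rigorous today only to all orders of perturbation theory (Reisz's lattice power counting, Reisz1988;
MeyerortmannsReisz2006
§3.3; Reisz–Rothe for GW fermions) and conjecturally the output of Bałaban-type block
renormalisation with fermions (Balaban1988Convergent).
Since the statement re-type of 2026-08-16 the conjunct also demands `reg.IsChiralAtZero` (the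
lattice gap closes as `m → 0⁺`, pinning the
additive offset of `m_crit`); this too is a statement the overlap world is built for: there the
chiral point is KNOWN (`m_crit ≡ 0`, exact
flavoured lattice chiral symmetry, Luscher1998) and Goldstone's alternative is an exact
finite-lattice Ward identity away
(`μ·G_ab(p=0) = δ_ab⟨ψ̄(1−aD/2)ψ⟩/a⁴`, Chandrasekharan1999 §3: a uniform gap down to `μ = 0⁺` forces
the condensate to vanish), so the new
crux OverlapGoldstone is posed with that lever in hand and the transfer returns gap closure to
Wilson with everything else.
Imported areas: lattice chiral fermion theory (GW/overlap/admissibility, exact Ward identities),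
matrix analysis (CFC sign function, Γ-hermitian pairing),
constructive RG; no probabilistic reformulation of the statement itself — the probability measure is
manufactured by the choice of cutoff.
No prior route existed on QuantumFields/QCD at filing; the negatives index (2026-08-16: 4 refuted
statements, none on overlap/chiral clauses) is respected.

RANKED CRUXES. #0 OverlapThesis (target) — X (rev 3): for N_f = 2 and 3, admissible-overlap lattice
QCD realises the overlap twin of the RE-TYPED conjunct body, `OverlapChiralQCDOf N_f` (one
mass-independent regularisation with leading-log mass scaling whose overlap lattice gap CLOSES at
zero mass at every large cutoff — `reg.OverlapGapClosesAtZero`, the subsequence-stable twin of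
`IsChiralAtZero` —; for every positive mass tuple OS data T reached by the overlap lattice Schwinger
functions, non-trivial non-Gaussian glue, dynamical flavours, a gap of T and a uniform
overlap-lattice gap) AND the two bodies together imply `QCD`. (why it might fail: X conjoins the
cruxes: the transfer must now match the fixed-k low lattice spectrum in BOTH directions and sit
m_crit(k) on the Wilson critical line non-perturbatively; the overlap half contains the QCD mass
gap, Goldstone's alternative and OS axioms (E1, E2) no 4d gauge construction has reached.)
[Neuberger1998, Luscher1998, Chandrasekharan1999, HernandezJansenLuscher1999, Reisz1988,
arXiv:hep-lat/9908013]
#2 WilsonOverlapTransfer (crux) — STRONG LATTICE UNIVERSALITY, joint over N_f ∈ {2,3}: `(∀ N_f ∈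
{2,3}, OverlapChiralQCDOf N_f) → QCD` — some WILSON regularisation realises `QCDOf 2 ∧ QCDOf 3`
including `IsChiralAtZero`: matched Λ via `afBeta`, `m_crit(k)` exactly on the Wilson critical line
(load-bearing since rev 3: gap CLOSURE must transfer, i.e. the fixed-k low spectrum is compared in
BOTH directions), `Z_m` ratio constant, species re-renormalised, Wilson lattice gap at possibly
smaller Δ'. [difficulty: open-problem] (why it might fail: Only PERTURBATIVE Wilson/overlap
universality is known (Reisz; Reisz–Rothe for GW quarks): the fixed-k low spectrum must match in
both directions and m_crit(k) must sit exactly on the Wilson critical line in the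
Aoki/Sharpe–Singleton region, where (D_W+m)⁻¹ on rough fields revives the sign problem.) [Reisz1988,
arXiv:hep-lat/9908013, MeyerortmannsReisz2006, Balaban1988Convergent, MohlerSchaefer2020,
SharpeSingleton1998]
#3 OverlapLatticeGap (crux) — POSITIVE-MEASURE INFRARED THEOREM AT THE CANONICAL CHIRAL POINT: for
N_f ∈ {2,3}, `∃ reg, reg.mcrit = 0 ∧ reg.HasMassScaling ∧ reg.HasOverlapGapAtPositiveMass` — an
overlap regularisation with m_crit ≡ 0 (exact GW chiral symmetry: no additive mass renormalisation,
so `m → 0⁺` is `μ → 0⁺` and no offset hides light quarks), a_k → 0, β_k asymptotically scaling, a_k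
L_k → ∞, leading-log Z_m, such that for EVERY positive mass tuple the bare masses lie eventually in
(0,2) and some Δ > 0 is a uniform overlap-lattice gap for all gauge-invariant local observables, all
large k, all tori 2S+1 ≥ 2L_k+1, n ≤ S, in the admissible-overlap expectation (probability measure).
[difficulty: open-problem] (why it might fail: Contains the QCD mass-gap problem for every m>0 down
to the TRUE chiral point: m_crit ≡ 0 removes the offset slack, so arbitrarily light pions must stay
gapped at some Δ(m)→0; positivity gives tools but no mechanism; ε-cut weight non-analytic, log
det(D_ov+μ) non-local at scale 1/μ.) [JaffeWitten2000, OsterwalderSeiler1978, SeilerLNP1982,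
Neuberger1998, Luscher1998, Luscher1999AbelianChiral, HernandezJansenLuscher1999]
#4 OverlapContinuumLimit (crux) — CONTINUUM LIMIT AND AXIOMS IN THE POSITIVE WORLD: for N_f ∈ {2,3},
`OverlapChiralGapPackage N_f → OverlapChiralQCDOf N_f` — along a reindexing of the sequence (which
preserves mass scaling, the eventual clauses and the STRONG chiral clause, not the literal `∃ᶠ` one)
the renormalised overlap lattice Schwinger functions converge on off-diagonal tensors, for every
positive mass tuple, to OS data T (E0–E4) with non-trivial non-Gaussian glue, dynamical flavours,
T.HasMassGap Δ and the overlap-lattice gap at the same Δ. [deps: OverlapLatticeGap,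
OverlapGoldstone] [difficulty: open-problem] (why it might fail: Interacting overlap reflection
positivity is open (Kikukawa–Usui 2010: free case only), so T's E2 must come from the continuum or
Wilson side; O(4) restoration is unproved for any 4d gauge theory; ONE subsequence must serve
uncountably many mass tuples; κ₃≠0 (non-Gaussian glue) needs a lower bound.) [KikukawaUsui2010,
arXiv:1005.3751, arXiv:1012.0152, OsterwalderSeiler1978, SeilerLNP1982, Balaban1988Convergent]
#5 OverlapGoldstone (crux, NEW at rev 3) — GOLDSTONE'S ALTERNATIVE IN THE OVERLAP WORLD: for N_f ∈
{2,3} and EVERY overlap regularisation with m_crit ≡ 0, leading-log mass scaling and asymptotic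
scaling, `reg.OverlapGapClosesAtZero`: for every ε > 0 some positive mass tuple and ONE pair of
local observables (a flavoured pion interpolator) violate the gap bound C e^{−ε a_k n} for every C,
EVENTUALLY in k, at some torus S ≥ L_k and time n ≤ S — massless N_f ≥ 2 overlap QCD is approached
gaplessly, uniformly on the lattice. Lever: Lüscher's exact flavoured chiral symmetry ⇒ the exact
lattice Ward identity μ·G_ab(p=0) = δ_ab⟨ψ̄(1−aD/2)ψ⟩/a⁴ (Chandrasekharan1999 §3), so a uniform gap
down to μ = 0⁺ forces a vanishing condensate: the crux is "no chirally symmetric GAPPED phase of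
massless N_f = 2, 3 QCD in the continuum regime" (Goldstone pions if Σ ≠ 0; massless baryons on the
exotic N_f = 2 anomaly-matching branch — gapless either way). The strong form survives the
reindexing in #4 and implies the literal twin (`OverlapGapClosesAtZero.overlapIsChiralAtZero`); it
composes with #3 on the SAME reg by logic in `closes`. [difficulty: open-problem] (why it might
fail: Needs massless N_f=2,3 QCD GAPLESS uniformly in k: SχSB / anomaly matching are heuristics
(rigorous SχSB only at strong coupling, Salmhofer–Seiler); a symmetric gapped phase as β_k→∞, μ→0⁺
is not excluded; the WI route needs χ_P ≤ C/ε with gap constants uniform in m, which the clause does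
not give.) [Chandrasekharan1999, Luscher1998, BanksCasher1980, VafaWitten1984,
FrishmanSchwimmerBanksYankielowicz1981, SalmhoferSeiler1991, HasenfratzLalienaNiedermayer1998,
LeutwylerSmilga1992, JaffeWitten2000]
#9 GinspargWilsonPositivity (support) — abstract pairing positivity: Γ a Hermitian involution, V
unitary and Γ-hermitian, |b| < a ⇒ det(a·1 + b·V) real and > 0; with Γ = Γ₅, V = Γ₅ sign(Γ₅D_W), a =
1+μ/2, b = 1−μ/2 this is det(D_ov+μ) > 0 for every μ > 0 (Literature: `det_smul_one_add_smul_pos`;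
exact it). [difficulty: provable-now] [Neuberger1998, MohlerSchaefer2020, MontvayMunster1994]
#9 OverlapDeterminantPositivity (support) — configuration by configuration, off the exceptional set
det(Γ₅D_W(U,−1,1)) = 0 and for μ > 0, det `qcdOverlapDirac U μ` is real and > 0 (now
`qcdOverlapDirac_det_re_pos` + `qcdOverlapDirac_det_im`, OverlapQCDOSDirac.lean; exact them).
[difficulty: provable-now] [Neuberger1998, Luscher1998, MohlerSchaefer2020]
#9 OverlapMeasurePositivity (support) — the N_f-flavour admissible-overlap gauge marginal is a
POSITIVE measure: (i) the exceptional set is Haar-null (proper real-algebraic subvariety; U ≡ 1 off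
it), (ii) `fermiIntegral (overlapBoltzmann U μ) = (−1)^(n(n−1)/2+n) ∏_f det D_(μ_f)(U)` (IS
`fermiIntegral_overlapBoltzmann`), (iii) hence `0 < ∫ (∏_f Re det D_(μ_f)) · overlapGaugeWeight β`
for β ≥ 0, μ_f > 0 (integrand positive off the exceptional set by `prod_det_qcdOverlapDirac_pos`,
`overlapGaugeWeight_pos_iff`; the admissible set is an open neighbourhood of U ≡ 1 of positive Haar
measure). Also what makes OverlapGoldstone non-vacuous for large k (β_k → ∞ ≥ 0, μ_f(k) → 0⁺: the
expectation is honest, not junk 0). [difficulty: provable-now] [Neuberger1998,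
Luscher1999AbelianChiral, MontvayMunster1994, Berezin1966]

TWO-LAYER PLAN. Foreseen glued splits (none filed now; k ≤ 3, depth 1): WilsonOverlapTransfer ⇐
TransferSchwinger (matched-parameter universality of the
renormalised lattice n-point functions incl. `HasMassScaling`/`m_crit` matching: the `IsQCDAlong`
half) → TransferLatticeGap (the fixed-k
Wilson lattice-gap clause from the overlap one plus Wilson reflection positivity / a block
comparison) → WilsonOverlapTransfer.
OverlapLatticeGap ⇐ HeavyCorner (all m_f above a large M: random-walk/polymer control of overlap
quark lines on the positive measure) →
PositiveMeasureIR (general m: the positivity-based infrared engine, shared with any robust-YM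
statement on the YangMills side) → OverlapLatticeGap.
OverlapContinuumLimit ⇐ Tightness (uniform moment bounds + limits for a countable dense set of mass
tuples, diagonal subsequence) →
AxiomsAndAllMasses (equicontinuity in m, E1 restoration, E2 sourced from the continuum/Wilson side,
κ₃ ≠ 0; the strong chiral clause rides through
the reindexing untouched) → OverlapContinuumLimit.
OverlapGoldstone ⇐ WardToSusceptibility (exact flavoured GW Ward identity on the admissible-overlap
torus: μ Σ_x⟨P^a(x)P^a(0)⟩ = ⟨ψ̄(1−D/2)ψ⟩-type,
plus: a uniform overlap-lattice gap ε at mass μ bounds the pion susceptibility by C(ε) uniformly in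
k — transfer-matrix spectral bound with
m-uniform constants) → CondensateFloor (lim inf_{μ→0⁺} of the subtracted condensate is > 0 uniformly
in large k: SχSB proper, Banks–Casher; or the
gapless exotic branch directly) → OverlapGoldstone.

KILL CRITERIA. A theorem that matched Wilson and admissible-overlap lattice QCD differ in the
infrared at fixed large k (an extra light lattice state, or
a Wilson lattice gap provably absent where the overlap one holds) refutes WilsonOverlapTransfer:
close `refuted:WilsonOverlapTransfer` unless the
refutation only hits the lattice-gap clause, in which case pivot (restate the transfer to the
`IsQCDAlong`/`T.HasMassGap` clauses and source the
Wilson lattice gap from Wilson RP + transferred decay). A disproof of the uniform overlap-lattice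
gap for some positive mass tuple refutes
OverlapLatticeGap and, morally, the conjunct itself — close `refuted:OverlapLatticeGap` and hand the
witness to the negative-side cards.
A theorem exhibiting a zero-offset, asymptotically scaling admissible-overlap regularisation (N_f =
2 or 3) with a uniform overlap-lattice gap
ε₀ > 0 at ALL positive mass tuples (a chirally symmetric gapped phase surviving β_k → ∞) refutes
OverlapGoldstone — and, through universality, the
re-typed conjunct's own `IsChiralAtZero`: close `refuted:OverlapGoldstone`, file the witness on the
negative side; if instead only the STRONG
(eventually-in-k) form dies while the literal `∃ᶠ` clause survives, restate OverlapGoldstone/the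
package to the literal twin and move the
subsequence bookkeeping into OverlapContinuumLimit (pivot, not close).
The support items are theorems (a sign change of det(D_ov+μ) is impossible by the pairing argument);
their refutation would mean a
mis-transcription of the overlap operator — restate, do not close. If a YangMills-side route lands a
positive-measure infrared theorem robust
under bounded positive quasi-local weights, OverlapLatticeGap becomes its corollary modulo
quark-line decay: expand, do not close. A direct
Wilson-side proof of `QCD` moots the route (superseded).

NOT DECOMPOSED YET. Bałaban block-spin machinery with fermions and the block-norm comparison class
(the METHOD behind WilsonOverlapTransfer — the crux is stated
by its deliverable); the Λ_W/Λ_O matching constant and the `m_crit(k)` tuning; the species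
transcription (Wilson glue excites a⁻¹ψ̄ψ at
leading order, audit N1, so the Wilson T' differs from the overlap T by a field redefinition — the
transfer only claims ∃T'); where T's
reflection positivity comes from (interacting overlap RP is open: continuum argument, or Wilson RP
after TransferSchwinger — a layer-2
child, not an item now); O(4) restoration; the Haar-null exceptional set and measurability of U ↦
sign(Γ₅D_W(U)) (inside the support items);
finite-volume (−1)^F-twisted-trace bookkeeping (time-periodic `wilsonDirac`, audit g8 N2), identical
in both worlds; for OverlapGoldstone: the
Grassmann derivation of the flavoured Ward identity inside `overlapTorusExpect` (change of variables
under Lüscher's rotation, `fermiIntegral`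
invariance), the pion interpolator as a `QCDLatticeObservable`, and the spectral (transfer-matrix)
passage from a uniform time-decay bound to a
susceptibility bound with m-uniform constants — none of them items now (layer-2 at most, via the
split above).

CHEAPEST FALSIFIER. (1) By hand (done): the pairing argument behind GinspargWilsonPositivity — V
unitary with conjugation-closed spectrum, |b| < a ⇒
det(a + bV) = ∏(a + b e^{iθ}) > 0; no sign change for ANY μ > 0. (2) Lookup (done): interacting
overlap RP is NOT known — Kikukawa–Usui
(KikukawaUsui2010 = arXiv:1005.3751, pp. 2–3, 10) prove the free case and leave gauge models open;
so OverlapContinuumLimit must not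
lean on overlap RP (flagged). (3) First real test of WilsonOverlapTransfer for a refuter: in any
controlled lattice model with two regularisations
sharing a continuum limit (free Wilson vs overlap fermions; 2d Schwinger/Gross–Neveu;
strong-coupling polymer regimes) find a matched pair where a
uniform lattice gap holds at fixed cutoff for one and fails for the other through a LOCAL defect
(extra light lattice state): then the fixed-k
half of the transfer is dead and the route pivots as in Kill criteria. (4) Numerics are no cheap
falsifier: the theorem-grade cut δ = 1/1800
deforms Wilson's weight by t²/δ, perturbatively large at accessible β (irrelevant as k → ∞, fatal
for a quick simulation). (5) For OverlapGoldstone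
(lookup, done): the only branch of massless N_f = 2 QCD without SχSB that 't Hooft anomaly matching
allows (massless baryons,
FrishmanSchwimmerBanksYankielowicz1981) is itself GAPLESS, so it does not falsify the crux as typed
(baryonic observables are admissible A, B);
a refuter's real test is a junk/degenerate `QCDRegularisation` meeting the three hypotheses with a
provable uniform gap — none exists short of
solving the infrared problem, since for large k the admissible-overlap expectation is an honest
positive measure (β_k → ∞ ≥ 0, μ_f(k) → 0⁺).

NUMBERS. Admissibility: trace cut t_p = Re tr(1−U_p) < δ = 1/1800 ⇒ ‖1−U_p‖ ≤ √(2t_p) < 1/30, the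
hypothesis of Hernández–Jansen–Lüscher's locality
theorem (HernandezJansenLuscher1999) and of Lüscher's smoothness/topology results
(Luscher1999AbelianChiral); overlap projection point m₀ = 1
(tree: `wilsonDirac U (−1) 1`, diagonal 3 = 4 − m₀), one massless species for 0 < m₀ < 2. Massive
overlap D_μ = (1+μ/2) + (1−μ/2)V: det > 0
for all μ > 0 (a = 1+μ/2 > |1−μ/2| = |b|). Berezin sign (−1)^(n(n−1)/2+n), n = 12·N_f·S⁴.
Leading-log mass exponent γ₀/(2β₀) = 4/9 (N_f = 3),
12/29 (N_f = 2) (tree `massExponent`). Wilson-side negativity the transfer must absorb: negative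
strange determinants on ≈2% (β = 3.4, 3.46),
0.3% (β = 3.55), 0.05% (β = 3.7) of CLS N_f = 2+1 configurations (MohlerSchaefer2020 §4.2). Items at
open: 8 (1 target, 3 cruxes, 3 support, 1 assembly); rev 2 (route-repair 2026-08-15): same 8 decls,
6 restated by name over OverlapQCDOS (defeq), Transfer/target re-aimed at `QCD`; rev 3 (route-repair
2026-08-16, statement re-type p117723): 9 items (1 target, 4 cruxes — OverlapGoldstone added at rank
5 —, 3 support, 1 assembly), 5 restated (OverlapThesis, WilsonOverlapTransfer, OverlapLatticeGap,
OverlapContinuumLimit, Assembly), closes re-certified over 4 hypotheses.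

DEFINITION REQUESTS. LANDED (2026-08-15):
Literature/MathematicalPhysics/QuantumFieldTheory/OverlapQCDOS.lean (`qcdOverlapDirac`,
`overlapDiracMatrix`,
`overlapBoltzmann`, `overlapGaugeCut`/`overlapGaugeWeight`, `overlapPartitionFn`,
`overlapTorusExpect`, `overlapLatticeConnectedCorr`,
`QCDScheme.OverlapHasLatticeMassGap`, `overlapLatticeSchwinger`, `IsOverlapQCDAlong`,
`OverlapQCDOf`, `OverlapGapPackage` — the (O) twins of the `QCDOS`
functionals, definitionally the rev-1 `let`s; the items are stated over them since rev 2),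
QuantumFieldTheory/OverlapQCDOSDirac.lean (Γ₅-hermiticity,
real and positive determinant of `qcdOverlapDirac`), QuantumLattice/OverlapDirac.lean (general
`overlapKernel`/`overlapUnitary`/`overlapDirac ρ U m₀ μ`,
Ginsparg–Wilson relation, Lüscher symmetry, the abstract pairing positivity
`det_smul_one_add_smul_pos`), QuantumLattice/OverlapLocality.lean
(norm admissibility `IsNormAdmissible`, the Hernández–Jansen–Lüscher constants
`hjlTheta`/`hjlT`/`hjlKappa`). LANDED (2026-08-16, p131219, section ChiralPoint of
OverlapQCDOS.lean): `QCDRegularisation.OverlapIsChiralAtZero` (literal twin of `IsChiralAtZero`),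
`QCDRegularisation.OverlapGapClosesAtZero`
(subsequence-stable strengthening; `OverlapGapClosesAtZero.overlapIsChiralAtZero`),
`QCDRegularisation.HasOverlapGapAtPositiveMass`
(`overlapGapPackage_iff : Iff.rfl`), `OverlapChiralQCDOf` (twin of the re-typed `QCDOf`; forgets to
`OverlapQCDOf`), `OverlapChiralGapPackage`. Still wanted: the HJL locality THEOREM as a
cited fact over that vocabulary (‖1−U_p‖ ≤ ε < 1/30 ⇒ |D_ov(x,y)| ≤ C e^(−γ|x−y|), Γ₅D_W(−1)² ≥ c(ε)
> 0) if not yet stated there; the exact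
flavoured GW Ward identity for `overlapTorusExpect` as a proved Literature lemma (first lemma of
OverlapGoldstone).
CONE (route-repair 2026-08-15, re-checked at rev 3). Used-constants cone of items + closes:
Literature vocabulary (QCDOS / OverlapQCDOS incl. section ChiralPoint), no sorry, whitelisted axioms
only; the only closed Props are the route's items and the Statement `QCD` (`QCDOf` reached via the
Statement only). The IMPORT cone is that of Summits/QuantumFields/QCD/Statement.lean itself, shared
by every QCD route; its unproved closed facts are not used by the theses (needs-fact,
guardrail-only: `not_isSimpleCompactGroup_unitaryGroup`; census hygiene, not debt:
`isSpecification_ymSpecification` (mis-stated; `_t2_holds` exists),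
ClayYangMillsEuclidean(Gap/Along), CaoParkSheffieldProblem).

Novelty: Searches (2026-08-15): `lit search --hybrid "reflection positivity overlap Dirac operator
Ginsparg-Wilson fermions"` (15 book hits: Bietenholz–Wiese 2025,
Montvay–Münster, Meyer-Ortmanns–Reisz §3.3 — read pp. 259–260, 267); `lit search "reflection
positivity overlap fermions Kikukawa Usui" --source all`
(crossref: KikukawaUsui2010, doi:10.22323/1.105.0267, Boriçi truncated overlap
doi:10.1007/978-94-011-4124-6_4; arXiv:1005.3751 read);
`lit search --hybrid "universality of the continuum limit different lattice actions rigorous proof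
gauge theory"` (12 textbook hits, no theorem beyond
perturbation theory); `lit galaxy search --star all` ×3 ("overlap Dirac operator positive
determinant" 0, "renormalization of lattice gauge theories with
massless Ginsparg" 0, "lattice power counting theorem" 2: panama Montvay–Münster,
pdf:3994402272862935500 = Reisz CMP 1988); `lit frontier QuantumFields
--since 2021` (30 rows: stochastic quantisation, YM–Higgs scaling limits arXiv:2401.10507, RP YM
constructions arXiv:2606.19362 — none on fermion
regularisation transfer); `lit bridges QuantumFields --cross any`; all 38 QCD idea cards listed
(`ledger idea list`), the card's own Distinguishes-from read.
Nearest prior art found: Neuberger1998 / Luscher1998 / GinspargWilson1982 (overlap, exact chiral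
symmetry, per-flavour positivity as folklore —
MohlerSchaefer2020 §1 states it), Luscher1999AbelianChiral + HernandezJansenLuscher1999
(admissibility ⇒ locality/topology), Reisz1988 +
MeyerortmannsReis  [refs: 10.22323/1.105.0267, 10.1007/978-94-011-4124-6_4, 1005.3751, 2401.10507, 2606.19362, hep-lat/0607020, doi:10.22323/1.105.0267, doi:10.1007/978-94-011-4124-6_4, KikukawaUsui2010, Neuberger1998, Luscher1998, GinspargWilson1982, MohlerSchaefer2020, HernandezJansenLuscher1999, Reisz1988, MeyerortmannsReisz2006]

Barriers (technique_class: regularisation-transfer, overlap-positivity): - technique_class: regularisation-transfer, overlap-positivity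
- Literature.Barriers.QuantumFields.NielsenNinomiya: evaded the standard way — overlap quarks
satisfy the Ginsparg–Wilson relation, not {γ₅,D} = 0; one species per flavour for 0 < m₀ < 2 (m₀ = 1
here), doublers at the cutoff.
- Literature.Barriers.QuantumFields.NoUltralocalGinspargWilson: APPLIES and is accepted — D_ov is
not ultralocal; every estimate in OverlapLatticeGap/OverlapContinuumLimit is posed for exponentially
local kernels, uniform thanks to the admissibility cut δ = 1/1800 (HJL's ‖1−U_p‖ < 1/30); the cost
is technical (locality constants), not conceptual.
- Literature.Barriers.QuantumFields.NoContinuousLatticeTopologicalCharge: not load-bearing; the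
index of D_ov is an integer locally constant on the ADMISSIBLE set, which the cut disconnects —
exactly the barrier's escape clause (it concerns everywhere-defined continuous charges on the full
configuration space).
- Literature.Barriers.QuantumFields.WilsonDeterminantSign: evaded by construction — no positivity is
ever claimed for Wilson quarks; the infrared analysis runs on the overlap measure where det(D_ov+μ)
> 0 per flavour is a theorem (GinspargWilsonPositivity); the Wilson signed weight appears only
inside WilsonOverlapTransfer, which uses no positivity (its why-might-fail records that the sign
problem returns if fixed-k transfer needs pathwise Wilson propagator control).
- Literature.Barriers.QuantumFields.WilsonDeterminantMassSplitting: same evas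

History (route lifecycle, newest last):
- 2026-08-15T16:49:18Z · rev 2: restated OverlapThesis (stmt-QuantumFields-8815), WilsonOverlapTransfer (stmt-QuantumFields-8816), OverlapLatticeGap (stmt-QuantumFields-8817), OverlapContinuumLimit (stmt-QuantumFields-8818), OverlapDeterminantPositivity (stmt-QuantumFields-8820), OverlapMeasurePositivity (stmt-QuantumFields-8821) — route-repai (planner-rrepair-QuantumFields-OverlapPositivit-ca6b88a0-g2-0)
- 2026-08-16T23:22:52Z · rev 3: restated OverlapThesis (stmt-QuantumFields-11150), WilsonOverlapTransfer (stmt-QuantumFields-11151), OverlapLatticeGap (stmt-QuantumFields-11152), OverlapContinuumLimit (stmt-QuantumFields-11153), Assembly (stmt-QuantumFields-8822) — route-repair rev 3 (statement-revised p117723: QCDOf conjoins reg.IsChiralAtZer (planner-rrepair-QuantumFields-OverlapPositivit-a8c6d0aa-0)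
- 2026-08-24T02:21:12Z · DORMANT — reconciler: no traction for 6.4 d (last activity item-evidence-added at 2026-08-17T14:57:03Z); parked, not closed — `ledger route dormant route-QuantumFields-Ov (operator:999:1010374)
- 2026-08-28T19:28:07Z · REACTIVATED — reconciler: reactivated — activity statement-closed at 2026-08-28T17:14:40Z after parking at 2026-08-24T02:21:12Z (operator:999:2898313)
- 2026-08-29T21:02:14Z · DORMANT — census g0: costume (trib-confirmed census-trib-costume-A 2026-08-29; 21-frontier 19:16:23Z (b)); reversible --off (operator:999:1747847)

sub-problem: QCD · status: dormant · opened planner-plancard-QuantumFields-QCD-overlap-po-4c2ceb41-0 2026-08-15T13:34:07Z · rev 4 · ledger route-QuantumFields-OverlapPositivityTransfer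
GENERATED by the gate from the ledger (D-0016/17). Provers cite these decls: `theorem foo : Summit.QuantumFields.QCD.Theses.OverlapPositivityTransfer.<Decl> := …` in Summits/QuantumFields/QCD/Theorems/<Name>.lean.
-/

namespace Summit.QuantumFields.QCD.Theses.OverlapPositivityTransfer

open scoped BigOperators Topology Manifold Classical MeasureTheory ProbabilityTheory Matrix InnerProductSpace ComplexConjugate ContinuousMap
open Filter Set Function TopologicalSpace MeasureTheory

attribute [summit_statement] _root_.QCD

-- earlier OverlapThesis (stmt-QuantumFields-11150, replaced 2026-08-16T23:22:52Z -> stmt-QuantumFields-17581): retired by None — (open Literature.MathematicalPhysics.QuantumFieldTheory in (∀ Nf : ℕ, Nf = 2 ∨ Nf = 3 → OverlapQCDOf Nf) ∧ ((∀ Nf : ℕ, Nf = 2 ∨ Nf = 3 → OverlapQCDOf Nf) → QCD))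
-- earlier OverlapThesis (stmt-QuantumFields-8815, replaced 2026-08-15T16:49:18Z -> stmt-QuantumFields-11150): retired by None — (open Literature.MathematicalPhysics.QuantumFieldTheory Literature.MathematicalPhysics.QuantumLattice Literature.MathematicalPhysics.AQFT in ∀ Nf : ℕ, Nf = 2 ∨ Nf = 3 → let ovD : (S : ℕ) → [NeZero S] → GaugeConfig 4 S (Matrix.specialUnitaryGroup (Fin 3) ℂ) → ℝ → Matrix (Lit
/-- item stmt-QuantumFields-17581 · target · rank 0 · open · by planner
why it might fail: X conjoins the cruxes: the transfer must now match the fixed-k low lattice spectrum in BOTH directions and sit m_crit(k) on the Wilson critical line non-perturbatively; the overlap half contains the QCD mass gap, Goldstone's alternative and OS axioms (E1, E2) no 4d gauge construction has reached.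
sources: Neuberger1998, Luscher1998, Chandrasekharan1999, HernandezJansenLuscher1999, Reisz1988, arXiv:hep-lat/9908013
[target] X (rev 3, statement re-type 2026-08-16): for N_f = 2 and N_f = 3, admissible-overlap
lattice QCD realises the overlap twin of the RE-TYPED conjunct body — `OverlapChiralQCDOf N_f` (one
mass-independent regularisation with leading-log mass scaling whose overlap lattice gap CLOSES at
zero mass at every large cutoff, `reg.OverlapGapClosesAtZero`, the subsequence-stable twin of
`reg.IsChiralAtZero`; for every positive mass tuple OS data T reached along the sequence by the
overlap lattice Schwinger functions, non-trivial non-Gaussian glue, dynamical flavours, a mass gap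
of T and a uniform overlap-lattice gap for all local observables) — AND these two overlap bodies
together imply `QCD` (the lattice-level universality transfer back to Wilson's scheme, chiral clause
included). [difficulty: open-problem] -/
@[route_item "route-QuantumFields-OverlapPositivityTransfer"]
def OverlapThesis : Prop :=
  (open Literature.MathematicalPhysics.QuantumFieldTheory in (∀ Nf : ℕ, Nf = 2 ∨ Nf = 3 → OverlapChiralQCDOf Nf) ∧ ((∀ Nf : ℕ, Nf = 2 ∨ Nf = 3 → OverlapChiralQCDOf Nf) → QCD))

-- earlier WilsonOverlapTransfer (stmt-QuantumFields-11151, replaced 2026-08-16T23:22:52Z -> stmt-QuantumFields-17582): retired by None — (open Literature.MathematicalPhysics.QuantumFieldTheory in (∀ Nf : ℕ, Nf = 2 ∨ Nf = 3 → OverlapQCDOf Nf) → QCD)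
-- earlier WilsonOverlapTransfer (stmt-QuantumFields-8816, replaced 2026-08-15T16:49:18Z -> stmt-QuantumFields-11151): retired by None — (open Literature.MathematicalPhysics.QuantumFieldTheory Literature.MathematicalPhysics.QuantumLattice Literature.MathematicalPhysics.AQFT in ∀ Nf : ℕ, Nf = 2 ∨ Nf = 3 → let ovD : (S : ℕ) → [NeZero S] → GaugeConfig 4 S (Matrix.specialUnitaryGroup (Fin 3) ℂ) → ℝ → Mat
/-- item stmt-QuantumFields-17582 · crux · rank 2 · open · by planner
why it might fail: Only PERTURBATIVE Wilson/overlap universality is known (Reisz; Reisz–Rothe for GW quarks): the fixed-k low spectrum must match in both directions and m_crit(k) must sit exactly on the Wilson critical line in the Aoki/Sharpe–Singleton region, where (D_W+m)⁻¹ on rough fields revives the sign problem.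
sources: Reisz1988, arXiv:hep-lat/9908013, MeyerortmannsReisz2006, Balaban1988Convergent, MohlerSchaefer2020, SharpeSingleton1998
[crux] STRONG LATTICE UNIVERSALITY (card U1, observable form), joint over N_f ∈ {2,3}; rev 3
(statement re-type 2026-08-16): if admissible-overlap lattice QCD realises the overlap twin of the
RE-TYPED conjunct body at N_f = 2 and at N_f = 3 (`OverlapChiralQCDOf N_f`: an overlap
regularisation with leading-log mass scaling whose overlap lattice gap closes at zero mass at every
large cutoff, and for every positive mass tuple OS data reached by the overlap lattice Schwinger
functions, non-triviality, dynamical flavours, a gap of T and a uniform overlap-lattice gap), then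
`QCD` — some WILSON regularisation realises `QCDOf 2` and `QCDOf 3` INCLUDING `reg.IsChiralAtZero`:
matched Λ-parameters via `afBeta`, `m_crit(k)` exactly ON the Wilson chiral critical line (now
load-bearing: the transfer must carry gap CLOSURE overlap ⇒ Wilson, i.e. compare the low-lying
lattice spectrum at fixed large k in BOTH directions — a uniform Wilson gap at matched parameters
has to force an overlap one; the strong overlap clause `OverlapGapClosesAtZero` hands it an
eventual-in-k violation by one fixed pion interpolator), `Z_m` ratio constant, species
re-renormalised; the Wilson lattice-gap clause at possibly -/
@[route_item "route-QuantumFields-OverlapPositivityTransfer", crux]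
def WilsonOverlapTransfer : Prop :=
  (open Literature.MathematicalPhysics.QuantumFieldTheory in (∀ Nf : ℕ, Nf = 2 ∨ Nf = 3 → OverlapChiralQCDOf Nf) → QCD)

-- earlier OverlapLatticeGap (stmt-QuantumFields-11152, replaced 2026-08-16T23:22:52Z -> stmt-QuantumFields-17583): retired by None — (open Literature.MathematicalPhysics.QuantumFieldTheory in ∀ Nf : ℕ, Nf = 2 ∨ Nf = 3 → OverlapGapPackage Nf)
-- earlier OverlapLatticeGap (stmt-QuantumFields-8817, replaced 2026-08-15T16:49:18Z -> stmt-QuantumFields-11152): retired by None — (open Literature.MathematicalPhysics.QuantumFieldTheory Literature.MathematicalPhysics.QuantumLattice Literature.MathematicalPhysics.AQFT in ∀ Nf : ℕ, Nf = 2 ∨ Nf = 3 → let ovD : (S : ℕ) → [NeZero S] → GaugeConfig 4 S (Matrix.specialUnitaryGroup (Fin 3) ℂ) → ℝ → Matrix 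
/-- item stmt-QuantumFields-17583 · crux · rank 3 · open · by planner
why it might fail: Contains the QCD mass-gap problem for every m>0 down to the TRUE chiral point: m_crit ≡ 0 removes the offset slack, so arbitrarily light pions must stay gapped at some Δ(m)→0; positivity gives tools but no mechanism; ε-cut weight non-analytic, log det(D_ov+μ) non-local at scale 1/μ.
sources: JaffeWitten2000, OsterwalderSeiler1978, SeilerLNP1982, Neuberger1998, Luscher1998, Luscher1999AbelianChiral
[crux] POSITIVE-MEASURE INFRARED THEOREM AT THE CANONICAL CHIRAL POINT (card U2, lattice half; rev
3, statement re-type 2026-08-16): for N_f ∈ {2,3} there is an overlap regularisation with m_crit ≡ 0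
— the chiral point of Ginsparg–Wilson quarks is KNOWN (Lüscher's exact flavoured lattice chiral
symmetry at μ = 0 forbids an additive mass renormalisation), so the bare overlap mass is μ_f(k) =
a_k m_f/Z_m(k), `m → 0⁺` IS `μ → 0⁺`, and no flavour-blind offset can hide light quarks (this is how
the route pins the offset that the conjunct's `IsChiralAtZero` pins physically) — with a_k → 0, β_k
two-loop asymptotically scaling, a_k L_k → ∞, Z_m of leading-log growth, such that for EVERY
positive renormalised mass tuple m the bare masses lie eventually in (0,2) and there is Δ > 0 with
‖⟨A·τ_{n e₀}B⟩ − ⟨A⟩⟨B⟩‖ ≤ C_{A,B} e^{−Δ a_k n} for all gauge-invariant local lattice observables A,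
B (Wilson loops, mesons, baryons), all large k, all tori 2S+1 ≥ 2L_k+1 and n ≤ S — computed in the
admissible-overlap expectation `overlapTorusExpect`, whose unquenched gauge marginal is a
probability measure (`reg.HasOverlapGapAtPositiveMass`; the rev-2 statement `OverlapGapPackage N_f`
is its offset-free weak -/
@[route_item "route-QuantumFields-OverlapPositivityTransfer", crux]
def OverlapLatticeGap : Prop :=
  (open Literature.MathematicalPhysics.QuantumFieldTheory in ∀ Nf : ℕ, Nf = 2 ∨ Nf = 3 → ∃ reg : QCDRegularisation Nf, reg.mcrit = 0 ∧ reg.HasMassScaling ∧ reg.HasOverlapGapAtPositiveMass)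

-- earlier OverlapContinuumLimit (stmt-QuantumFields-11153, replaced 2026-08-16T23:22:52Z -> stmt-QuantumFields-17584): retired by None — (open Literature.MathematicalPhysics.QuantumFieldTheory in ∀ Nf : ℕ, Nf = 2 ∨ Nf = 3 → OverlapGapPackage Nf → OverlapQCDOf Nf)
-- earlier OverlapContinuumLimit (stmt-QuantumFields-8818, replaced 2026-08-15T16:49:18Z -> stmt-QuantumFields-11153): retired by None — (open Literature.MathematicalPhysics.QuantumFieldTheory Literature.MathematicalPhysics.QuantumLattice Literature.MathematicalPhysics.AQFT in ∀ Nf : ℕ, Nf = 2 ∨ Nf = 3 → let ovD : (S : ℕ) → [NeZero S] → GaugeConfig 4 S (Matrix.specialUnitaryGroup (Fin 3) ℂ) → ℝ → Mat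
/-- item stmt-QuantumFields-17584 · crux · rank 4 · open · by planner
why it might fail: Interacting overlap reflection positivity is open (Kikukawa–Usui 2010: free case only), so T's E2 must come from the continuum or Wilson side; O(4) restoration is unproved for any 4d gauge theory; ONE subsequence must serve uncountably many mass tuples; κ₃≠0 (non-Gaussian glue) needs a lower bound.
sources: KikukawaUsui2010, arXiv:1005.3751, arXiv:1012.0152, OsterwalderSeiler1978, SeilerLNP1982, Balaban1988Convergent
[crux] CONTINUUM LIMIT AND AXIOMS IN THE POSITIVE WORLD (card U2, continuum half; rev 3, statement
re-type 2026-08-16): for N_f ∈ {2,3}, the CHIRAL lattice-gap package (`OverlapChiralGapPackage N_f`: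
one regularisation with leading-log mass scaling whose overlap lattice gap closes at zero mass at
every large cutoff, `OverlapGapClosesAtZero`, and which has, for every positive mass tuple,
asymptotic scaling, bare overlap masses eventually in (0,2) and a uniform overlap-lattice gap)
implies the overlap twin of the RE-TYPED conjunct body (`OverlapChiralQCDOf N_f`): along (a
reindexing k ↦ φ(k), φ strictly monotone, of) the sequence — which preserves `HasMassScaling`, every
eventual clause and the STRONG chiral clause (but NOT the literal negated-eventually clause, whence
the strong form upstream) — the renormalised overlap lattice Schwinger functions of glue and of the
pseudoscalar bilinears converge on off-diagonal tensors, for every positive mass tuple, to OS data T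
(E0–E4 incl. Euclidean invariance and reflection positivity) with non-trivial, non-Gaussian glue,
every flavour-changing pseudoscalar non-trivial, T.HasMassGap Δ and the overlap-lattice gap at the
same Δ. [deps: OverlapLa -/
@[route_item "route-QuantumFields-OverlapPositivityTransfer", crux]
def OverlapContinuumLimit : Prop :=
  (open Literature.MathematicalPhysics.QuantumFieldTheory in ∀ Nf : ℕ, Nf = 2 ∨ Nf = 3 → OverlapChiralGapPackage Nf → OverlapChiralQCDOf Nf)

/-- item stmt-QuantumFields-17586 · crux · rank 5 · open · by planner
why it might fail: Needs massless N_f=2,3 QCD GAPLESS uniformly in k: SχSB / anomaly matching are heuristics (rigorous SχSB only at strong coupling, Salmhofer–Seiler); a symmetric gapped phase as β_k→∞, μ→0⁺ is not excluded; the WI route needs χ_P ≤ C/ε with gap constants uniform in m, which the clause does not give.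
sources: Chandrasekharan1999, Luscher1998, BanksCasher1980, VafaWitten1984, FrishmanSchwimmerBanksYankielowicz1981, SalmhoferSeiler1991
[crux] GOLDSTONE'S ALTERNATIVE IN THE OVERLAP WORLD (new at rev 3, statement re-type 2026-08-16 —
supplies, on the overlap side, the twin of the conjunct's new clause `reg.IsChiralAtZero`): for N_f
∈ {2,3} and EVERY overlap regularisation at the canonical chiral point (m_crit ≡ 0) with leading-log
mass scaling and two-loop asymptotic scaling, the overlap lattice gap CLOSES as m → 0⁺ at every
large cutoff (`reg.OverlapGapClosesAtZero`): for every ε > 0 there are a positive mass tuple m and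
ONE pair of gauge-invariant local lattice observables A, B (a flavoured pion interpolator) such that
for every constant C, EVENTUALLY in k, some torus S ≥ L_k and Euclidean time n ≤ S give ‖⟨A·τ_{n
e₀}B⟩ − ⟨A⟩⟨B⟩‖ > C e^{−ε a_k n} — massless N_f ≥ 2 overlap QCD is approached GAPLESSLY, uniformly
on the lattice. The lever exists only in this world: Lüscher's exact flavoured chiral symmetry gives
the exact finite-lattice Ward identity μ·G_ab(p=0) = δ_ab ⟨ψ̄(1−aD/2)ψ⟩/a⁴ (Chandrasekharan §3), so
a uniform gap ε down to μ = 0⁺ would force the condensate to vanish in the chiral limit: the crux is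
`no chirally symmetric GAPPED phase of massless N_f = 2, 3 QCD in the continuum regime` — Goldstone
pions i -/
@[route_item "route-QuantumFields-OverlapPositivityTransfer", crux]
def OverlapGoldstone : Prop :=
  (open Literature.MathematicalPhysics.QuantumFieldTheory in ∀ Nf : ℕ, Nf = 2 ∨ Nf = 3 → ∀ reg : QCDRegularisation Nf, reg.mcrit = 0 → reg.HasMassScaling → (∀ m : Fin Nf → ℝ, (∀ f, 0 < m f) → (reg.scheme m 0 0).HasAsymptoticScaling) → reg.OverlapGapClosesAtZero)

/-- item stmt-QuantumFields-17895 · crux · rank 6 · open · by planner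
why it might fail: Asks k-UNIFORM E0' bounds, calibrated non-trivial limits with a κ₃≠0 lower bound and k-uniform exponential clustering for 4d AF gauge theory with overlap quarks, one subsequence for all masses — Clay-grade UV/IR; the per-pair lattice gap gives no uniform constants (no overlap transfer matrix).
sources: JaffeWitten2000, Balaban1988Convergent, OsterwalderSeiler1978, GlimmJaffeQP1987, OS1973, HernandezJansenLuscher1999
[crux] PIECE A of the typed decomposition of OverlapContinuumLimit (BC2 redirect, cstrat 2026-08-17)
— THE UV/IR ENGINE OF THE POSITIVE OVERLAP WORLD, OS-CLOSED MODULO REFLECTION POSITIVITY AND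
ROTATIONS: for N_f ∈ {2,3}, from the chiral gap package, one regularisation reg (leading-log mass
scaling, overlap gap closing at zero at every large cutoff) and, for EVERY positive mass tuple m,
species renormalisations z, shift and a labelled Schwinger family S such that reg.scheme m z shift
scales asymptotically with bare overlap masses eventually in (0,2); the renormalised overlap lattice
Schwinger functions CONVERGE to S on off-diagonal real tensors (one sequence for all masses); S is
normalised (E0), hermitian, of linear growth (E0'), translation invariant, symmetric (E3),
clustering (E4); S carries explicit non-triviality witnesses for glue and every flavour-changing
pseudoscalar (truncated two-point function ≠ 0 at a time-separated pair) and a κ₃ ≠ 0 witness for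
glue; and S has the species mass gap S.HasMassGap Δ together with the overlap-lattice gap at the
same Δ > 0. Everything here is provable by Euclidean estimates on a POSITIVE measure (no transfer
matrix needed): k-uniform boun -/
@[route_item "route-QuantumFields-OverlapPositivityTransfer"]
def OverlapConvergentClosure : Prop :=
  (open Literature.MathematicalPhysics.QuantumFieldTheory Literature.MathematicalPhysics.QuantumLattice Literature.MathematicalPhysics.AQFT in ∀ Nf : ℕ, Nf = 2 ∨ Nf = 3 → OverlapChiralGapPackage Nf → ∃ reg : QCDRegularisation Nf, reg.HasMassScaling ∧ reg.OverlapGapClosesAtZero ∧ ∀ m : Fin Nf → ℝ, (∀ f, 0 < m f) → ∃ (z shift : QCDField Nf → ℕ → ℝ) (S : LabelledSchwingerFamily (QCDField Nf) (EuclideanSpace ℝ (Fin 4))), (reg.scheme m z shift).HasAsymptoticScaling ∧ (∀ fl : Fin Nf, ∀ᶠ k in Filter.atTop, 0 < (reg.scheme m z shift).mq fl k ∧ (reg.scheme m z shift).mq fl k < 2) ∧ (∀ n : ℕ, n ≠ 0 → ∀ (σ : Fin n → QCDField Nf) (f : Fin n → SchwartzMap (EuclideanSpace ℝ (Fin 4))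 ℝ) (F : SchwartzMap (Fin n → EuclideanSpace ℝ (Fin 4)) ℂ), IsTensorOf F (fun i => ofRealTest (f i)) → IsOffDiagonal F → Filter.Tendsto (fun k : ℕ => overlapLatticeSchwinger (reg.scheme m z shift) k n σ f) Filter.atTop (nhds (S n σ F))) ∧ S.IsNormalized ∧ S.IsHermitian ∧ S.HasLinearGrowth ∧ (∀ (n : ℕ) (σ : Fin n → QCDField Nf) (a : EuclideanSpace ℝ (Fin 4)) (F : SchwartzMap (Fin n → EuclideanSpace ℝ (Fin 4)) ℂ), IsOffDiagonal F → S n σ (translateMulti a F) = S n σ F) ∧ S.IsSymmetric ∧ S.HasClusterProperty ∧ (∀ s : QCDField Nf, (s = QCDField.glue ∨ ∃ f g : Fin Nf, f ≠ g ∧ s = QCDField.pseudoRe f g) → ∃ (F G : SchwartzMap (Fin 1 → EuclideanSpace ℝ (Fin 4)) ℂ) (H : SchwartzMap (Fin (1 + 1) → EuclideanSpace ℝ (Fin 4)) ℂ), IsTimeOrdered F ∧ IsTimeOrdered G ∧ IsAppendTensorOf H (osAdjoint F) G ∧ S (1 + 1) (fun _ => s) H ≠ S 1 (fun _ => s) (osAdjoint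 F) * S 1 (fun _ => s) G) ∧ (∃ (f g h : SchwartzMap (EuclideanSpace ℝ (Fin 4)) ℂ) (Ffgh : SchwartzMap (Fin 3 → EuclideanSpace ℝ (Fin 4)) ℂ) (Fgh Ffh Ffg : SchwartzMap (Fin 2 → EuclideanSpace ℝ (Fin 4)) ℂ) (Ff Fg Fh : SchwartzMap (Fin 1 → EuclideanSpace ℝ (Fin 4)) ℂ), IsTensorOf Ffgh ![f, g, h] ∧ IsOffDiagonal Ffgh ∧ IsTensorOf Fgh ![g, h] ∧ IsTensorOf Ffh ![f, h] ∧ IsTensorOf Ffg ![f, g] ∧ IsTensorOf Ff ![f] ∧ IsTensorOf Fg ![g] ∧ IsTensorOf Fh ![h] ∧ S 3 (fun _ => QCDField.glue) Ffgh - S 1 (fun _ => QCDField.glue) Ff * S 2 (fun _ => QCDField.glue) Fgh - S 1 (fun _ => QCDField.glue) Fg * S 2 (fun _ => QCDField.glue) Ffh - S 1 (fun _ => QCDField.glue) Fh * S 2 (fun _ => QCDField.glue) Ffg + 2 * (S 1 (fun _ => QCDField.glue) Ff * S 1 (fun _ => QCDField.glue) Fg * S 1 (fun _ => QCDField.glue)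 Fh) ≠ 0) ∧ ∃ Δ > 0, S.HasMassGap Δ ∧ (reg.scheme m z shift).OverlapHasLatticeMassGap Δ)

/-- item stmt-QuantumFields-17896 · crux · rank 7 · open · by planner
why it might fail: Exact lattice RP fails for the admissibility-cut weight (Creutz 2004) and is open for interacting overlap quarks (Kikukawa–Usui 2010): E2 must EMERGE as a_k→0, but cut-scale violations are only power-small in a_k against power-law renormalisations z(k); universal over ALL AF overlap schemes.
sources: Creutz2004, KikukawaUsui2010, arXiv:1005.3751, Luscher1977, OsterwalderSeiler1978
[crux] PIECE B — REFLECTION POSITIVITY OF CONTINUUM LIMITS OF ADMISSIBLE-OVERLAP LATTICE QCD: for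
N_f ∈ {2,3}, every overlap scheme sch with two-loop asymptotic scaling, bare overlap masses
eventually in (0,2) and a uniform overlap-lattice gap, and every NORMALISED labelled Schwinger
family S which is the limit of the renormalised overlap lattice Schwinger functions of sch on
off-diagonal real tensors, is reflection positive (E2, finite-list OS form). Exact LATTICE
reflection positivity is FALSE for the admissibility-cut plaquette weight (Creutz 2004: a weight
vanishing on an open region is incompatible with a positive transfer matrix) and open for
interacting overlap quarks (Kikukawa–Usui 2010, free case only), so E2 must emerge in the limit:
asymptotic positivity of the OS forms on positive-time real tensors (registered line
Lines/OverlapLimitPositivity_birth.lean) or Schwinger-function universality with Wilson (Lüscher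
1977 / Osterwalder–Seiler site-RP on the branch m > −1). The hypothesis S.IsNormalized pins the
arity-0 functional (cf. negatives stmt-QuantumFields-9665). (why it might fail: Exact lattice RP
fails for the admissibility-cut weight (Creutz 2004) and is open for in -/
@[route_item "route-QuantumFields-OverlapPositivityTransfer"]
def OverlapLimitPositivity : Prop :=
  (open Literature.MathematicalPhysics.QuantumFieldTheory Literature.MathematicalPhysics.QuantumLattice Literature.MathematicalPhysics.AQFT in ∀ Nf : ℕ, Nf = 2 ∨ Nf = 3 → ∀ (sch : QCDScheme Nf) (S : LabelledSchwingerFamily (QCDField Nf) (EuclideanSpace ℝ (Fin 4))), sch.HasAsymptoticScaling → (∀ fl : Fin Nf, ∀ᶠ k in Filter.atTop, 0 < sch.mq fl k ∧ sch.mq fl k < 2) → (∃ Δ : ℝ, 0 < Δ ∧ sch.OverlapHasLatticeMassGap Δ) → S.IsNormalized → (∀ n : ℕ, n ≠ 0 → ∀ (σ : Fin n → QCDField Nf) (f : Fin n → SchwartzMap (EuclideanSpace ℝ (Fin 4)) ℝ) (F : SchwartzMap (Fin n → EuclideanSpace ℝ (Fin 4)) ℂ), IsTensorOf F (fun i =>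 ofRealTest (f i)) → IsOffDiagonal F → Filter.Tendsto (fun k : ℕ => overlapLatticeSchwinger sch k n σ f) Filter.atTop (nhds (S n σ F))) → S.IsReflectionPositive)

/-- item stmt-QuantumFields-17897 · crux · rank 8 · open · by planner
why it might fail: No non-perturbative O(4)-restoration theorem exists in d=4 (Glimm–Jaffe Thm 17.9.1 excepts Euclidean covariance of lattice limits); needs k-uniform a²×(dimension-6) Symanzik insertion bounds for overlap quarks; universal over ALL AF overlap schemes and all limits S.
sources: Symanzik1983, DKKMO2020Rotational, CaraccioloEtAl1990, GlimmJaffeQP1987, HernandezJansenLuscher1999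
[crux] PIECE C — E1 MODULE OF THE OVERLAP WORLD (overlap twin of
GapBuysCauchyRate.RotationRestoration, restricted to N_f ∈ {2,3}): for every overlap scheme with
two-loop asymptotic scaling, bare overlap masses eventually in (0,2) and a uniform overlap-lattice
gap, every labelled Schwinger family S that is the k → ∞ limit of the renormalised overlap lattice
Schwinger functions on off-diagonal real tensor test functions is invariant under proper rotations
on ⁰𝒮 (the rotation half of IsEuclideanInvariant; translations are in piece A). Registered line
Lines/OverlapRotationRestoration_birth.lean: the Symanzik rotation defect of the renormalised
functions under linActTest R tends to 0 (overlap quarks are automatically O(a)-improved; HJL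
locality), plus a density/continuity closure. (why it might fail: No non-perturbative
O(4)-restoration theorem exists in d=4 (Glimm–Jaffe Thm 17.9.1 excepts Euclidean covariance of
lattice limits); needs k-uniform a²×(dimension-6) Symanzik insertion bounds for overlap quarks;
universal over ALL AF overlap schemes and all limits S.) [sources: Symanzik1983,
DKKMO2020Rotational, CaraccioloEtAl1990, GlimmJaffeQP1987, HernandezJansenLuscher1999] -/
@[route_item "route-QuantumFields-OverlapPositivityTransfer"]
def OverlapRotationRestoration : Prop :=
  (open Literature.MathematicalPhysics.QuantumFieldTheory Literature.MathematicalPhysics.QuantumLattice Literature.MathematicalPhysics.AQFT in ∀ Nf : ℕ, Nf = 2 ∨ Nf = 3 → ∀ (sch : QCDScheme Nf) (S : LabelledSchwingerFamily (QCDField Nf) (EuclideanSpace ℝ (Fin 4))), sch.HasAsymptoticScaling → (∀ fl : Fin Nf, ∀ᶠ k in Filter.atTop, 0 < sch.mq fl k ∧ sch.mq fl k < 2) → (∃ Δ : ℝ, 0 < Δ ∧ sch.OverlapHasLatticeMassGap Δ) → (∀ n : ℕ, n ≠ 0 → ∀ (σ : Fin n → QCDField Nf) (f : Fin n → SchwartzMap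 (EuclideanSpace ℝ (Fin 4)) ℝ) (F : SchwartzMap (Fin n → EuclideanSpace ℝ (Fin 4)) ℂ), IsTensorOf F (fun i => ofRealTest (f i)) → IsOffDiagonal F → Filter.Tendsto (fun k : ℕ => overlapLatticeSchwinger sch k n σ f) Filter.atTop (nhds (S n σ F))) → ∀ (n : ℕ) (σ : Fin n → QCDField Nf) (R : EuclideanSpace ℝ (Fin 4) ≃ₗᵢ[ℝ] EuclideanSpace ℝ (Fin 4)), LinearMap.det (R.toLinearEquiv : EuclideanSpace ℝ (Fin 4) →ₗ[ℝ] EuclideanSpace ℝ (Fin 4)) = 1 → ∀ F : SchwartzMap (Fin n → EuclideanSpace ℝ (Fin 4)) ℂ, IsOffDiagonal F → S n σ (linActMulti R F) = S n σ F)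

-- earlier OverlapDeterminantPositivity (stmt-QuantumFields-8820, replaced 2026-08-15T16:49:18Z -> stmt-QuantumFields-11154): retired by None — (open Literature.MathematicalPhysics.QuantumFieldTheory Literature.MathematicalPhysics.QuantumLattice Literature.MathematicalPhysics.AQFT in ∀ (S : ℕ) [NeZero S] (U : GaugeConfig 4 S (Matrix.specialUnitaryGroup (Fin 3) ℂ)) (μ : ℝ), 0 < μ → (spinorLift gammaFi
/-- item stmt-QuantumFields-11154 · support · rank 9 · closed · proved by Summit.QuantumFields.QCD.Theorems.overlapPositivityTransfer_overlapDeterminantPositivity_proof (prover) · by planner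
sources: Neuberger1998, Luscher1998, MohlerSchaefer2020
[support] POSITIVITY OF THE MASSIVE OVERLAP DETERMINANT, configuration by configuration: for every
torus, every SU(3) gauge field U off the exceptional set det(Γ₅D_W(U,−1,1)) = 0 and every μ > 0, det
`qcdOverlapDirac U μ` = det[(1+μ/2) + (1−μ/2)Γ₅·sign(Γ₅D_W(U,−1,1))] is real and strictly positive
(instantiate GinspargWilsonPositivity). Rev 2: by name, defeq to rev 1; now literally
`qcdOverlapDirac_det_re_pos` + `qcdOverlapDirac_det_im`
(Literature/MathematicalPhysics/QuantumFieldTheory/OverlapQCDOSDirac.lean) — exact them.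
[difficulty: provable-now] -/
@[route_item "route-QuantumFields-OverlapPositivityTransfer"]
def OverlapDeterminantPositivity : Prop :=
  (open Literature.MathematicalPhysics.QuantumFieldTheory Literature.MathematicalPhysics.QuantumLattice in ∀ (S : ℕ) [NeZero S] (U : GaugeConfig 4 S (Matrix.specialUnitaryGroup (Fin 3) ℂ)) (μ : ℝ), 0 < μ → (spinorLift gammaFive * wilsonDirac (fundamentalRep (Fin 3)) U (-1) 1).det ≠ 0 → 0 < (qcdOverlapDirac U μ).det.re ∧ (qcdOverlapDirac U μ).det.im = 0)

-- `OverlapDeterminantPositivity` holds: proved by `Summit.QuantumFields.QCD.Theorems.overlapPositivityTransfer_overlapDeterminantPositivity_proof` (its module imports this route file, so no `_holds` link can be stated here).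

-- earlier OverlapMeasurePositivity (stmt-QuantumFields-8821, replaced 2026-08-15T16:49:18Z -> stmt-QuantumFields-11155): retired by None — (open Literature.MathematicalPhysics.QuantumFieldTheory Literature.MathematicalPhysics.QuantumLattice Literature.MathematicalPhysics.AQFT in ∀ (Nf S : ℕ) [NeZero S] (β : ℝ) (μ : Fin Nf → ℝ), 0 ≤ β → (∀ f, 0 < μ f) → let ovD : (S : ℕ) → [NeZero S] → GaugeConfig 4 
/-- item stmt-QuantumFields-11155 · support · rank 9 · closed · proved by Summit.QuantumFields.QCD.Theorems.OverlapMeasurePositivity.overlapPositivityTransfer_overlapMeasurePositivity_proof (prover) · by planner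
sources: Neuberger1998, Luscher1999AbelianChiral, MontvayMunster1994, Berezin1966
[support] THE N_f-FLAVOUR ADMISSIBLE-OVERLAP GAUGE MARGINAL IS A POSITIVE MEASURE: (i) the
exceptional set det(Γ₅D_W(U,−1,1)) = 0 is null for the product Haar measure (a proper real-algebraic
subvariety: the free field U ≡ 1 is not on it); (ii) Gaussian Berezin integral + flavour
block-diagonality: `fermiIntegral (overlapBoltzmann U μ) = (−1)^(n(n−1)/2+n) ∏_f det
(qcdOverlapDirac U μ_f)`, n = #quark variables; (iii) hence `0 < ∫ (∏_f Re det D_(μ_f)) ·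
overlapGaugeWeight β` for all β ≥ 0, all tori and all positive bare masses (the admissible set is an
open neighbourhood of U ≡ 1 of positive Haar measure). Rev 2: by name over OverlapQCDOS, defeq
(`Iff.rfl`) to rev 1; (ii) IS `fermiIntegral_overlapBoltzmann` with `det_overlapDiracMatrix`, the
integrand of (iii) is positive off the exceptional set by `prod_det_qcdOverlapDirac_pos` and
`overlapGaugeWeight_pos_iff`; (i) and the positive Haar mass of the admissible neighbourhood are the
remaining content. [difficulty: provable-now] -/
@[route_item "route-QuantumFields-OverlapPositivityTransfer"]
def OverlapMeasurePositivity : Prop :=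
  (open Literature.MathematicalPhysics.QuantumFieldTheory Literature.MathematicalPhysics.QuantumLattice in ∀ (Nf S : ℕ) [NeZero S] (β : ℝ) (μ : Fin Nf → ℝ), 0 ≤ β → (∀ f, 0 < μ f) → (∀ᵐ U ∂(MeasureTheory.Measure.pi fun _ : Edge 4 S => haarProbability (Matrix.specialUnitaryGroup (Fin 3) ℂ)), (spinorLift gammaFive * wilsonDirac (fundamentalRep (Fin 3)) U (-1) 1).det ≠ 0) ∧ (∀ U : GaugeConfig 4 S (Matrix.specialUnitaryGroup (Fin 3) ℂ), fermiIntegral (overlapBoltzmann U μ) = (-1 : ℂ) ^ (Fintype.card (FermiIdx Nf S) * (Fintype.card (FermiIdx Nf S) - 1) / 2 + Fintype.card (FermiIdx Nf S)) * ∏ f, (qcdOverlapDirac U (μ f)).det) ∧ 0 < ∫ U, (∏ f, (qcdOverlapDirac U (μ f)).det.re) * overlapGaugeWeight β U ∂(MeasureTheory.Measure.pi fun _ : Edge 4 S => haarProbability (Matrix.specialUnitaryGroup (Fin 3) ℂ)))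

-- `OverlapMeasurePositivity` holds: proved by `Summit.QuantumFields.QCD.Theorems.OverlapMeasurePositivity.overlapPositivityTransfer_overlapMeasurePositivity_proof` (its module imports this route file, so no `_holds` link can be stated here).

/-- item stmt-QuantumFields-8819 · support · rank 9 · closed · proved by Summit.QuantumFields.QCD.Theorems.overlapPositivityTransfer_ginspargWilsonPositivity_proof (prover) · by planner
sources: Neuberger1998, MohlerSchaefer2020, MontvayMunster1994
[support] ABSTRACT GINSPARG–WILSON POSITIVITY (card U3, matrix form): if Γ is a Hermitian
involution, V unitary and Γ-hermitian (ΓVΓ = Vᴴ — so the spectrum of V is closed under conjugation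
with multiplicity), then det(a·1 + b·V) is real and > 0 whenever |b| < a (conjugate pairs give |·|²,
the real eigenvalues ±1 of V give a ± b > 0). With Γ = Γ₅, V = Γ₅ sign(Γ₅D_W), a = 1+μ/2, b = 1−μ/2
this is det(D_ov + μ) > 0 for every μ > 0. [difficulty: provable-now] -/
@[route_item "route-QuantumFields-OverlapPositivityTransfer"]
def GinspargWilsonPositivity : Prop :=
  ∀ (n : Type) [Fintype n] [DecidableEq n] (Γ V : Matrix n n ℂ), Γ.IsHermitian → Γ * Γ = 1 → V ∈ Matrix.unitaryGroup n ℂ → Γ * V * Γ = Vᴴ → ∀ a b : ℝ, |b| < a → 0 < (Matrix.det ((a : ℂ) • (1 : Matrix n n ℂ) + (b : ℂ) • V)).re ∧ (Matrix.det ((a : ℂ) • (1 : Matrix n n ℂ) + (b : ℂ) • V)).im = 0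

-- `GinspargWilsonPositivity` holds: proved by `Summit.QuantumFields.QCD.Theorems.overlapPositivityTransfer_ginspargWilsonPositivity_proof` (its module imports this route file, so no `_holds` link can be stated here).

-- earlier Assembly (stmt-QuantumFields-8822, replaced 2026-08-16T23:22:52Z -> stmt-QuantumFields-17585): retired by None — OverlapLatticeGap → OverlapContinuumLimit → WilsonOverlapTransfer → QCD
/-- item stmt-QuantumFields-17585 · assembly · rank 1 · closed · proved by Summit.QuantumFields.QCD.Theorems.overlapPositivityTransfer_assembly_proof (prover) · by planner
sources: JaffeWitten2000, OsterwalderSeiler1978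
[assembly] OverlapLatticeGap → OverlapGoldstone → OverlapContinuumLimit → WilsonOverlapTransfer →
QCD (rev 3: at N_f = 2, 3 take the zero-offset gap package, add the Goldstone closure of the SAME
regularisation, upgrade the chiral package to the chiral overlap body, transfer the pair to `QCD` —
literally the type of the deciding theorem `closes`). -/
@[route_item "route-QuantumFields-OverlapPositivityTransfer"]
def Assembly : Prop :=
  OverlapLatticeGap → OverlapGoldstone → OverlapContinuumLimit → WilsonOverlapTransfer → QCD

-- `Assembly` holds: proved by `Summit.QuantumFields.QCD.Theorems.overlapPositivityTransfer_assembly_proof` (its module imports this route file, so no `_holds` link can be stated here).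

/-! D-0027 §2.1 — DECIDING THEOREM (planner-authored via `route open/edit --closes-file`; by planner-rrepair-QuantumFields-OverlapPositivit-a8c6d0aa-0 2026-08-16T23:22:52Z):
its hypotheses are this route's items and its conclusion the sub-problem Statement (glue_lint), and it elaborates with this file. -/

@[closes "route-QuantumFields-OverlapPositivityTransfer"] theorem closes : OverlapLatticeGap → OverlapGoldstone → OverlapContinuumLimit → WilsonOverlapTransfer → QCD :=
  fun hA hG hB hC => hC fun Nf hNf => hB Nf hNf <| by
    obtain ⟨reg, h0, hMS, hbody⟩ := hA Nf hNf
    exact ⟨reg, hMS, hG Nf hNf reg h0 hMS (fun m hm => (hbody m hm).1), hbody⟩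

end Summit.QuantumFields.QCD.Theses.OverlapPositivityTransfer
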